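import Summits.BirchSwinnertonDyer.BirchSwinnertonDyer.Theorems.GenusKolyvaginAtTwoPowDvdShaCardAtTwoRTOrderFourAuxiliaryDeep
import Summits.BirchSwinnertonDyer.BirchSwinnertonDyer.Theorems.SchneiderFreeAdditiveX3PoitouTateSelmerComplementCanonical
import HarnessLib

/-!
# Route `GenusKolyvaginAtTwo`, crux L_T `PowDvdShaCardAtTwoRT` (stmt-BirchSwinnertonDyer-23242), LINE 18 stub L, bottom rung:
# AUXILIARY + RECIPROCITY FOR THE CANONICAL POITOU–TATE FAMILY (the `inv`-hypotheses of `…RTOrderFourAuxiliaryDeep` discharged)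

Width seat `bsd-line-gk2-p4` g18 (cell `bsd-f1-sign2`), `--supports 23242 --as helper`.  THEOREMS ONLY (no definition, no named
fact, no `sorry`; standard axioms).  BSD is NOT proved by any of this; neither is the crux nor stub L.

WHY.  `DeepOwnPrime.exists_auxiliary_bottomRung(_twin)` (p703833) takes a family `inv` of local invariant maps with `SumLocalTermEqZero`
and injectivity on `s ∪ t`.  For THE canonical family `LocalInvariants.canonical ℚ 4` both are tree theorems (`canonical_isPerfect`,
`sumLocalTermEqZero_canonical`), so the S-bot auxiliary-with-reciprocity statement holds with NO `inv`-input: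
* **`exists_auxiliary_bottomRung_canonical`**, `exists_auxiliary_bottomRung_twin_canonical`.
The remaining inputs are the Kolyvagin-prime data of `s ∪ t` (`hTK`, level-`4` `FrobEqFrobInfty` on `t`) and, per `Z`, the three displayed
properties (`2•Z` Kummer off `s ∪ t ∪ {l′}`, `loc(2•Z) = 0` on `s`, `2•Z` transverse on `t`).  Closes nothing.  BSD is NOT proved.

References: [McCallumLMS1991] §5 proof of Prop. 5.2; [MilneADT2006] Ch. I Cor. 2.3, Thm. 4.10; [GrossLMS1991] §3 (3.2)–(3.3).
-/

set_option autoImplicit false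
-- the Theorems namespace of this sub repeats the summit name by design (D-0017 nested layout)
set_option linter.dupNamespace false

noncomputable section

open scoped Classical

open CategoryTheory Field NumberField IsDedekindDomain Function
open _root_.WeierstrassCurve
open Literature.NumberTheory.EllipticCurves
open Literature.NumberTheory.GaloisRepresentations
open Literature.NumberTheory.GaloisCohomology
open Summit.BirchSwinnertonDyer.Rank1Residual.X11b.KummerPT
open Summit.BirchSwinnertonDyer.Rank1Residual.X11b.FiniteDuality
open Summit.BirchSwinnertonDyer.Rank1Residual.X11b.Relaxation
open scoped ContRepresentation

namespace Summit.BirchSwinnertonDyer.BirchSwinnertonDyer.Theorems.GenusExact.DeepOwnPrime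

open Summit.BirchSwinnertonDyer.BirchSwinnertonDyer.Theorems.GenusExact.RelaxedCount

/-! ## §1 THE canonical Poitou–Tate family: `inv`-hypotheses discharged -/

section Canonical

variable (W : WeierstrassCurve ℚ) [W.IsElliptic] [W.IsGloballyMinimal]
variable (e : geomTorsion W ((2 ^ 2 : ℕ) : ℤ) → geomTorsion W ((2 ^ 2 : ℕ) : ℤ) → AlgebraicClosure ℚ)
  (hμ : ∀ S T, e S T ^ (2 ^ 2) = 1)
  (hadd₁ : ∀ S₁ S₂ T, e (S₁ + S₂) T = e S₁ T * e S₂ T)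
  (hadd₂ : ∀ S T₁ T₂, e S (T₁ + T₂) = e S T₁ * e S T₂)
  (hgal : ∀ (σ : absoluteGaloisGroup ℚ) (S T : geomTorsion W ((2 ^ 2 : ℕ) : ℤ)), σ • e S T = e (σ • S) (σ • T))
  (halt : ∀ T, e T T = 1) (hnondeg : ∀ T, (∀ S, e S T = 1) → T = 0)

include halt hnondeg in
/-- **Auxiliary + reciprocity for THE canonical family of local invariant maps** `LocalInvariants.canonical ℚ 4` (injective at every
finite place by `canonical_isPerfect`, reciprocity `sumLocalTermEqZero_canonical`): `exists_auxiliary_bottomRung` with the two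
`inv`-hypotheses discharged. [cite: McCallumLMS1991, §5 proof of Prop. 5.2] [cite: MilneADT2006, Ch. I, Thm. 4.10] -/
theorem exists_auxiliary_bottomRung_canonical (hΔ : W.Δ < 0) (hρ2 : W.HasSurjectiveModNGaloisRep 2)
    {K : Type} [Field K] [NumberField K] (s t : Finset (Place ℚ)) (hst : Disjoint s t) (hs : s.Nonempty)
    (hTK : ∀ u ∈ s ∪ t, ∃ (v : HeightOneSpectrum (𝓞 ℚ)) (ℓ : ℕ) (_ : Fact ℓ.Prime), u = Sum.inr v ∧ ℓ ≠ 2 ∧ (ℓ : 𝓞 ℚ) ∈ v.asIdeal ∧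
      W.HasGoodReductionAtPrime ℓ ∧ FrobEqFrobInfty W K 2 ℓ ∧ 2 ≤ Zhang2014.kolyvaginIndex W 2 ℓ)
    (ht4 : ∀ (v : HeightOneSpectrum (𝓞 ℚ)) (ℓ : ℕ), ℓ.Prime → Sum.inr v ∈ t → (ℓ : 𝓞 ℚ) ∈ v.asIdeal →
      FrobEqFrobInfty W K (2 ^ 2) ℓ) :
    ∃ y ∈ kummerOutside W (2 ^ 2) (s ∪ t), 2 • y ≠ 0 ∧
      ∀ l' : Place ℚ, l' ∉ s ∪ t →
        ∀ Z : galoisCohomology (W.torsionGaloisModule ((2 ^ 2 : ℕ) : ℤ)) 1,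
          (2 : ℕ) • Z ∈ kummerOutside W (2 ^ 2) (insert l' (s ∪ t)) →
          (∀ u ∈ s, galoisCohomology.localization (W.torsionGaloisModule ((2 ^ 2 : ℕ) : ℤ)) u 1 ((2 : ℕ) • Z) = 0) →
          (∀ v : HeightOneSpectrum (𝓞 ℚ), Sum.inr v ∈ t →
            ∀ 𝔓 ∈ v.primesAbove, ∀ F c₀ : absoluteGaloisGroup ℚ, IsArithFrobAt (𝓞 ℚ) F 𝔓 →
              IsComplexConjugation (Rat.castHom ℝ) c₀ → (∀ P : geomTorsion W ((2 ^ 2 : ℕ) : ℤ), F • P = c₀ • P) →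
              ∃ P₁ : geomTorsion W ((2 ^ 2 : ℕ) : ℤ), h1Eval W _ ((2 : ℕ) • Z) F = F • P₁ - P₁) →
          invWeilPairing W (2 ^ 2) e hμ hadd₁ hadd₂ hgal (LocalInvariants.canonical ℚ (2 ^ 2)) l'
            (galoisCohomology.localization (W.torsionGaloisModule ((2 ^ 2 : ℕ) : ℤ)) l' 1 ((2 : ℕ) • Z))
            (galoisCohomology.localization (W.torsionGaloisModule ((2 ^ 2 : ℕ) : ℤ)) l' 1 y) = 0 := by
  haveI : NeZero (2 ^ 2) := ⟨by norm_num⟩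
  exact exists_auxiliary_bottomRung W e hμ hadd₁ hadd₂ hgal halt hnondeg (LocalInvariants.canonical ℚ (2 ^ 2)) hΔ hρ2 s t hst hs hTK
    ht4 (fun v _ ↦ ((LocalInvariants.canonical_isPerfect (K := ℚ) (n := 2 ^ 2)) v).1.1)
    (Summit.BirchSwinnertonDyer.BirchSwinnertonDyer.Theorems.SchneiderFreeAdditiveX3.PoitouTateReduction.sumLocalTermEqZero_canonical
      (K := ℚ) (2 ^ 2))

end Canonical

section CanonicalTwin

open Summit.BirchSwinnertonDyer.BirchSwinnertonDyer.Theorems.GenusExact.TwinGrossPrimes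

variable (W : WeierstrassCurve ℚ) [W.IsElliptic] [W.IsGloballyMinimal]
variable (Wd : WeierstrassCurve ℚ) [Wd.IsElliptic] [Wd.IsGloballyMinimal]
variable (e : geomTorsion Wd ((2 ^ 2 : ℕ) : ℤ) → geomTorsion Wd ((2 ^ 2 : ℕ) : ℤ) → AlgebraicClosure ℚ)
  (hμ : ∀ S T, e S T ^ (2 ^ 2) = 1)
  (hadd₁ : ∀ S₁ S₂ T, e (S₁ + S₂) T = e S₁ T * e S₂ T)
  (hadd₂ : ∀ S T₁ T₂, e S (T₁ + T₂) = e S T₁ * e S T₂)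
  (hgal : ∀ (σ : absoluteGaloisGroup ℚ) (S T : geomTorsion Wd ((2 ^ 2 : ℕ) : ℤ)), σ • e S T = e (σ • S) (σ • T))
  (halt : ∀ T, e T T = 1) (hnondeg : ∀ T, (∀ S, e S T = 1) → T = 0)

include halt hnondeg in
/-- **The twin side for THE canonical family.** [cite: McCallumLMS1991, §5 proof of Prop. 5.2] [cite: GrossLMS1991, §3 (3.2)–(3.3)] -/
theorem exists_auxiliary_bottomRung_twin_canonical {K : Type} [Field K] [NumberField K]
    (hK : IsImaginaryQuadratic K) (hodd : Odd (NumberField.discr K)) (hΔ : W.Δ < 0) (hρ2 : W.HasSurjectiveModNGaloisRep 2)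
    {C : VariableChange ℚ} (hC : C • W.quadraticTwist ((NumberField.discr K : ℤ) : ℚ) = Wd)
    (s t : Finset (Place ℚ)) (hst : Disjoint s t) (hs : s.Nonempty)
    (hTK : ∀ u ∈ s ∪ t, ∃ (v : HeightOneSpectrum (𝓞 ℚ)) (ℓ : ℕ) (_ : Fact ℓ.Prime), u = Sum.inr v ∧ ℓ ≠ 2 ∧ (ℓ : 𝓞 ℚ) ∈ v.asIdeal ∧
      ¬ ((ℓ : ℤ) ∣ NumberField.discr K) ∧ W.HasGoodReductionAtPrime ℓ ∧ FrobEqFrobInfty W K 2 ℓ ∧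
      2 ≤ Zhang2014.kolyvaginIndex W 2 ℓ)
    (ht4 : ∀ (v : HeightOneSpectrum (𝓞 ℚ)) (ℓ : ℕ), ℓ.Prime → Sum.inr v ∈ t → (ℓ : 𝓞 ℚ) ∈ v.asIdeal →
      FrobEqFrobInfty W K (2 ^ 2) ℓ) :
    ∃ y ∈ kummerOutside Wd (2 ^ 2) (s ∪ t), 2 • y ≠ 0 ∧
      ∀ l' : Place ℚ, l' ∉ s ∪ t →
        ∀ Z : galoisCohomology (Wd.torsionGaloisModule ((2 ^ 2 : ℕ) : ℤ)) 1,
          (2 : ℕ) • Z ∈ kummerOutside Wd (2 ^ 2) (insert l' (s ∪ t)) →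
          (∀ u ∈ s, galoisCohomology.localization (Wd.torsionGaloisModule ((2 ^ 2 : ℕ) : ℤ)) u 1 ((2 : ℕ) • Z) = 0) →
          (∀ v : HeightOneSpectrum (𝓞 ℚ), Sum.inr v ∈ t →
            ∀ 𝔓 ∈ v.primesAbove, ∀ F c₀ : absoluteGaloisGroup ℚ, IsArithFrobAt (𝓞 ℚ) F 𝔓 →
              IsComplexConjugation (Rat.castHom ℝ) c₀ → (∀ P : geomTorsion Wd ((2 ^ 2 : ℕ) : ℤ), F • P = c₀ • P) →
              ∃ P₁ : geomTorsion Wd ((2 ^ 2 : ℕ) : ℤ), h1Eval Wd _ ((2 : ℕ) • Z) F = F • P₁ - P₁) →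
          invWeilPairing Wd (2 ^ 2) e hμ hadd₁ hadd₂ hgal (LocalInvariants.canonical ℚ (2 ^ 2)) l'
            (galoisCohomology.localization (Wd.torsionGaloisModule ((2 ^ 2 : ℕ) : ℤ)) l' 1 ((2 : ℕ) • Z))
            (galoisCohomology.localization (Wd.torsionGaloisModule ((2 ^ 2 : ℕ) : ℤ)) l' 1 y) = 0 := by
  haveI : NeZero (2 ^ 2) := ⟨by norm_num⟩
  exact exists_auxiliary_bottomRung_twin W Wd e hμ hadd₁ hadd₂ hgal halt hnondeg (LocalInvariants.canonical ℚ (2 ^ 2)) hK hodd hΔ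
    hρ2 hC s t hst hs hTK ht4 (fun v _ ↦ ((LocalInvariants.canonical_isPerfect (K := ℚ) (n := 2 ^ 2)) v).1.1)
    (Summit.BirchSwinnertonDyer.BirchSwinnertonDyer.Theorems.SchneiderFreeAdditiveX3.PoitouTateReduction.sumLocalTermEqZero_canonical
      (K := ℚ) (2 ^ 2))

end CanonicalTwin

end Summit.BirchSwinnertonDyer.BirchSwinnertonDyer.Theorems.GenusExact.DeepOwnPrime

end
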